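import Summits.RiemannHypothesis.RiemannHypothesis.Theorems.WeilGroundStateGroundStatesConvergeToXiZeroSideEulerLagrange
import Literature.NumberTheory.LFunctions.ZetaZerosReflection
import Literature.NumberTheory.LFunctions.WeilZeroSum
import Literature.NumberTheory.LFunctions.WeilExplicitProofs
import Mathlib.Analysis.Real.Sqrt
import Mathlib.Analysis.Normed.Group.InfiniteSum
import Mathlib.Topology.Algebra.InfiniteSum.Real
import HarnessLib

/-!
# Stub `stub_zeroSideEnergy` of the line `Sketch` (crux `WeilGroundState.GroundStatesConvergeToXi`,
item stmt-RiemannHypothesis-1527, rev L9)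

**W11b — the RH-free zero-side energy identity of a Weil ground state.**  Let `u` be a ground
state at the window `a` with minimising sequence `gₙ → u` (`IsWeilGroundState a u`).  Assuming
the `ℓ²(m)`-convergence of the zero samples along the minimising sequence (the conclusion of the
neighbouring stub `stub_samplingCauchy`, taken here as the hypothesis `HC`):
`Σ_ρ m(ρ)|û(ρ)|² < ∞`, `Σ_ρ m(ρ)|ĝₙ(ρ) - û(ρ)|² → 0`, we prove the explicit formula AT the
ground state,
`Σ_ρ m(ρ) û(ρ) conj û(1 - ρ̄) = ε(a)`.

Proof.  For each `n`, `Σ_ρ m(ρ) ĝₙ(ρ) conj ĝₙ(1 - ρ̄) = Q(gₙ)`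
(`hasSum_zeroSide_weilConv_weilReflect`), and `Q(gₙ) = Re Q(gₙ) → ε(a)`
(`weilQuadratic_im_holds`, definition of a ground state).  The reflection `ρ ↦ 1 - ρ̄` is an
involution of the non-trivial zeros preserving multiplicities
(`riemannZetaZeroOrder_one_sub_conj`), so the reflected samples converge in `ℓ²(m)` as well
(`zeroSideEnergy_reindex`).  The sesquilinear pairing `(x, y) ↦ Σ m x conj y` is jointly
continuous on `ℓ²(m)` by the weighted Cauchy–Schwarz inequality
(`zeroSideEnergy_summable_and_tsum_le`, from Mathlib's `Real.sum_mul_le_sqrt_mul_sqrt` on finite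
partial sums), whence `Σ_ρ m(ρ) ĝₙ(ρ) conj ĝₙ(1 - ρ̄) → Σ_ρ m(ρ) û(ρ) conj û(1 - ρ̄)`
(`zeroSideEnergy_tendsto_pairing`), and the two limits agree.

Mathlib + proved tree material only; no named fact; no definitions; standard axioms.
-/

set_option linter.dupNamespace false

noncomputable section

open MeasureTheory Complex Filter Set
open scoped Real Topology ComplexConjugate

namespace Summit.RiemannHypothesis.RiemannHypothesis.Theorems.GroundStatesConvergeToXi

open Literature.NumberTheory.LFunctions

/-! ### Weighted Cauchy–Schwarz -/

/-- Weighted Cauchy–Schwarz for finite sums: for a non-negative weight `m` and real families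
`x, y`, `Σ_{i ∈ s} m i (x i y i) ≤ √(Σ_{i ∈ s} m i x i²) √(Σ_{i ∈ s} m i y i²)`. [folklore] -/
theorem zeroSideEnergy_sum_le {ι : Type*} (s : Finset ι) {m : ι → ℝ} (hm : ∀ i, 0 ≤ m i)
    (x y : ι → ℝ) :
    ∑ i ∈ s, m i * (x i * y i) ≤
      √(∑ i ∈ s, m i * x i ^ 2) * √(∑ i ∈ s, m i * y i ^ 2) := by
  have h := Real.sum_mul_le_sqrt_mul_sqrt s (fun i ↦ √(m i) * x i) (fun i ↦ √(m i) * y i)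
  have h1 : ∀ i, √(m i) * x i * (√(m i) * y i) = m i * (x i * y i) := fun i ↦ by
    have hi := Real.mul_self_sqrt (hm i)
    calc √(m i) * x i * (√(m i) * y i) = (√(m i) * √(m i)) * (x i * y i) := by ring
      _ = m i * (x i * y i) := by rw [hi]
  have h2 : ∀ (z : ι → ℝ) (i : ι), (√(m i) * z i) ^ 2 = m i * z i ^ 2 := fun z i ↦ by
    rw [mul_pow, Real.sq_sqrt (hm i)]
  simp only [h1, h2] at h
  exact h

/-- Weighted Cauchy–Schwarz in `ℓ²(m)`: if `m, x, y ≥ 0` and `Σ m x²`, `Σ m y²` converge, then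
`Σ m x y` converges and `Σ m x y ≤ √(Σ m x²) √(Σ m y²)` (all finite partial sums are so bounded,
`zeroSideEnergy_sum_le`). [folklore] -/
theorem zeroSideEnergy_summable_and_tsum_le {ι : Type*} {m x y : ι → ℝ} (hm : ∀ i, 0 ≤ m i)
    (hx : ∀ i, 0 ≤ x i) (hy : ∀ i, 0 ≤ y i) (hX : Summable fun i ↦ m i * x i ^ 2)
    (hY : Summable fun i ↦ m i * y i ^ 2) :
    Summable (fun i ↦ m i * (x i * y i)) ∧
      ∑' i, m i * (x i * y i) ≤ √(∑' i, m i * x i ^ 2) * √(∑' i, m i * y i ^ 2) := by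
  have hnn : 0 ≤ fun i ↦ m i * (x i * y i) := fun i ↦ mul_nonneg (hm i) (mul_nonneg (hx i) (hy i))
  have hle : ∀ s : Finset ι, ∑ i ∈ s, m i * (x i * y i) ≤
      √(∑' i, m i * x i ^ 2) * √(∑' i, m i * y i ^ 2) := by
    intro s
    refine (zeroSideEnergy_sum_le s hm x y).trans ?_
    exact mul_le_mul
      (Real.sqrt_le_sqrt (hX.sum_le_tsum s fun i _ ↦ mul_nonneg (hm i) (sq_nonneg _)))
      (Real.sqrt_le_sqrt (hY.sum_le_tsum s fun i _ ↦ mul_nonneg (hm i) (sq_nonneg _)))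
      (Real.sqrt_nonneg _) (Real.sqrt_nonneg _)
  exact ⟨summable_of_sum_le hnn hle, Real.tsum_le_of_sum_le hnn hle⟩

/-! ### Continuity of the weighted pairing -/

/-- **Joint continuity of the pairing `Σ m x conj y` on `ℓ²(m)`.**  Let `m ≥ 0` be a weight,
`A, A'` two families with `Σ m|A|², Σ m|A'|² < ∞`, and `Bₙ → A`, `B'ₙ → A'` in `ℓ²(m)`
(`Σ m|Bₙ - A|² → 0`, `Σ m|B'ₙ - A'|² → 0`).  Then `Σ m A conj A'` converges absolutely and
`Σ m Bₙ conj B'ₙ → Σ m A conj A'`: with `Dₙ = Bₙ - A`, `D'ₙ = B'ₙ - A'`,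
`Bₙ conj B'ₙ - A conj A' = Dₙ conj D'ₙ + Dₙ conj A' + A conj D'ₙ`, and each piece is bounded in
`ℓ¹(m)` by weighted Cauchy–Schwarz. [folklore] -/
theorem zeroSideEnergy_tendsto_pairing {ι : Type*} {m : ι → ℝ} (hm : ∀ i, 0 ≤ m i)
    {A A' : ι → ℂ} {B B' : ℕ → ι → ℂ}
    (hA : Summable fun i ↦ m i * ‖A i‖ ^ 2) (hA' : Summable fun i ↦ m i * ‖A' i‖ ^ 2)
    (hB : ∀ n, Summable fun i ↦ m i * ‖B n i - A i‖ ^ 2)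
    (hB' : ∀ n, Summable fun i ↦ m i * ‖B' n i - A' i‖ ^ 2)
    (hδ : Tendsto (fun n ↦ ∑' i, m i * ‖B n i - A i‖ ^ 2) atTop (𝓝 0))
    (hδ' : Tendsto (fun n ↦ ∑' i, m i * ‖B' n i - A' i‖ ^ 2) atTop (𝓝 0)) :
    Summable (fun i ↦ (m i : ℂ) * (A i * conj (A' i))) ∧
      Tendsto (fun n ↦ ∑' i, (m i : ℂ) * (B n i * conj (B' n i))) atTop
        (𝓝 (∑' i, (m i : ℂ) * (A i * conj (A' i)))) := by
  -- the four Cauchy–Schwarz bounds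
  have c0 := zeroSideEnergy_summable_and_tsum_le hm (fun i ↦ norm_nonneg (A i))
    (fun i ↦ norm_nonneg (A' i)) hA hA'
  have c1 := fun n ↦ zeroSideEnergy_summable_and_tsum_le hm (fun i ↦ norm_nonneg (B n i - A i))
    (fun i ↦ norm_nonneg (B' n i - A' i)) (hB n) (hB' n)
  have c2 := fun n ↦ zeroSideEnergy_summable_and_tsum_le hm (fun i ↦ norm_nonneg (B n i - A i))
    (fun i ↦ norm_nonneg (A' i)) (hB n) hA'
  have c3 := fun n ↦ zeroSideEnergy_summable_and_tsum_le hm (fun i ↦ norm_nonneg (A i))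
    (fun i ↦ norm_nonneg (B' n i - A' i)) hA (hB' n)
  -- summability of the limit terms
  have hnorm_t : ∀ i, ‖(m i : ℂ) * (A i * conj (A' i))‖ = m i * (‖A i‖ * ‖A' i‖) := fun i ↦ by
    simp only [norm_mul, Complex.norm_real, Real.norm_eq_abs, abs_of_nonneg (hm i),
      Complex.norm_conj]
  have hsum_t : Summable (fun i ↦ (m i : ℂ) * (A i * conj (A' i))) :=
    Summable.of_norm (c0.1.congr fun i ↦ (hnorm_t i).symm)
  -- the difference of the terms and its bound
  have hdiff : ∀ n i, (m i : ℂ) * (B n i * conj (B' n i)) - (m i : ℂ) * (A i * conj (A' i)) =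
      (m i : ℂ) * ((B n i - A i) * conj (B' n i - A' i) + (B n i - A i) * conj (A' i) +
        A i * conj (B' n i - A' i)) := by
    intro n i
    simp only [map_sub]
    ring
  have hbd : ∀ n i, ‖(m i : ℂ) * (B n i * conj (B' n i)) - (m i : ℂ) * (A i * conj (A' i))‖ ≤
      m i * (‖B n i - A i‖ * ‖B' n i - A' i‖) + m i * (‖B n i - A i‖ * ‖A' i‖) +
        m i * (‖A i‖ * ‖B' n i - A' i‖) := by
    intro n i
    rw [hdiff, norm_mul, Complex.norm_real, Real.norm_eq_abs, abs_of_nonneg (hm i)]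
    have h3 := norm_add₃_le (a := (B n i - A i) * conj (B' n i - A' i))
      (b := (B n i - A i) * conj (A' i)) (c := A i * conj (B' n i - A' i))
    simp only [norm_mul, Complex.norm_conj] at h3
    have h4 := mul_le_mul_of_nonneg_left h3 (hm i)
    rw [mul_add, mul_add] at h4
    exact h4
  have hF : ∀ n, Summable fun i ↦
      m i * (‖B n i - A i‖ * ‖B' n i - A' i‖) + m i * (‖B n i - A i‖ * ‖A' i‖) +
        m i * (‖A i‖ * ‖B' n i - A' i‖) := fun n ↦ ((c1 n).1.add (c2 n).1).add (c3 n).1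
  -- abbreviations for the four sums of squares
  set S : ℝ := ∑' i, m i * ‖A i‖ ^ 2 with hS
  set S' : ℝ := ∑' i, m i * ‖A' i‖ ^ 2 with hS'
  set δ : ℕ → ℝ := fun n ↦ ∑' i, m i * ‖B n i - A i‖ ^ 2 with hδdef
  set δ' : ℕ → ℝ := fun n ↦ ∑' i, m i * ‖B' n i - A' i‖ ^ 2 with hδ'def
  have hF_tsum : ∀ n, ∑' i, (m i * (‖B n i - A i‖ * ‖B' n i - A' i‖) +
      m i * (‖B n i - A i‖ * ‖A' i‖) + m i * (‖A i‖ * ‖B' n i - A' i‖)) ≤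
      √(δ n) * √(δ' n) + √(δ n) * √S' + √S * √(δ' n) := by
    intro n
    rw [((c1 n).1.add (c2 n).1).tsum_add (c3 n).1, (c1 n).1.tsum_add (c2 n).1]
    exact add_le_add (add_le_add (c1 n).2 (c2 n).2) (c3 n).2
  -- summability of the differences and of the approximating terms
  have hnd : ∀ n, Summable fun i ↦
      ‖(m i : ℂ) * (B n i * conj (B' n i)) - (m i : ℂ) * (A i * conj (A' i))‖ := fun n ↦
    Summable.of_nonneg_of_le (fun i ↦ norm_nonneg _) (hbd n) (hF n)
  have hsum_T : ∀ n, Summable (fun i ↦ (m i : ℂ) * (B n i * conj (B' n i))) := fun n ↦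
    ((Summable.of_norm (hnd n)).add hsum_t).congr fun i ↦ sub_add_cancel _ _
  -- the key estimate
  have hkey : ∀ n, ‖∑' i, (m i : ℂ) * (B n i * conj (B' n i)) -
      ∑' i, (m i : ℂ) * (A i * conj (A' i))‖ ≤
      √(δ n) * √(δ' n) + √(δ n) * √S' + √S * √(δ' n) := by
    intro n
    rw [← (hsum_T n).tsum_sub hsum_t]
    exact (norm_tsum_le_tsum_norm (hnd n)).trans
      (((hnd n).tsum_le_tsum (hbd n) (hF n)).trans (hF_tsum n))
  -- the bound tends to zero
  have h0 : Tendsto (fun n ↦ √(δ n)) atTop (𝓝 0) := by simpa using hδ.sqrt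
  have h0' : Tendsto (fun n ↦ √(δ' n)) atTop (𝓝 0) := by simpa using hδ'.sqrt
  have hb : Tendsto (fun n ↦ √(δ n) * √(δ' n) + √(δ n) * √S' + √S * √(δ' n)) atTop (𝓝 0) := by
    simpa using ((h0.mul h0').add (h0.mul_const (√S'))).add (h0'.const_mul (√S))
  exact ⟨hsum_t, tendsto_sub_nhds_zero_iff.mp (squeeze_zero_norm hkey hb)⟩

/-! ### Reindexing by the reflection `ρ ↦ 1 - ρ̄` -/

/-- Reindexing a weighted sum over the non-trivial zeros by the reflection `ρ ↦ 1 - ρ̄`, an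
involution of the non-trivial zeros (`one_sub_conj_mem`) preserving the multiplicities
(`riemannZetaZeroOrder_one_sub_conj`): for every `f : ℂ → ℝ`,
`Σ_ρ m(ρ) f(1 - ρ̄) = Σ_ρ m(ρ) f(ρ)`, one side converging iff the other does. [folklore] -/
theorem zeroSideEnergy_reindex (f : ℂ → ℝ) :
    (Summable (fun ρ : ZetaZeros.riemannZetaNontrivialZeros ↦
        (riemannZetaZeroOrder (ρ : ℂ) : ℝ) * f (1 - conj (ρ : ℂ))) ↔
      Summable (fun ρ : ZetaZeros.riemannZetaNontrivialZeros ↦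
        (riemannZetaZeroOrder (ρ : ℂ) : ℝ) * f ρ)) ∧
    ∑' ρ : ZetaZeros.riemannZetaNontrivialZeros,
        (riemannZetaZeroOrder (ρ : ℂ) : ℝ) * f (1 - conj (ρ : ℂ)) =
      ∑' ρ : ZetaZeros.riemannZetaNontrivialZeros, (riemannZetaZeroOrder (ρ : ℂ) : ℝ) * f ρ := by
  set J : ZetaZeros.riemannZetaNontrivialZeros → ZetaZeros.riemannZetaNontrivialZeros :=
    fun ρ ↦ ⟨1 - conj (ρ : ℂ), ZetaZeros.riemannZetaNontrivialZeros.one_sub_conj_mem ρ.2⟩ with hJ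
  have hJJ : Function.Involutive J := by
    intro ρ
    apply Subtype.ext
    simp [hJ]
  have hmJ : ∀ ρ : ZetaZeros.riemannZetaNontrivialZeros,
      riemannZetaZeroOrder (1 - conj (ρ : ℂ)) = riemannZetaZeroOrder (ρ : ℂ) := fun ρ ↦
    riemannZetaZeroOrder_one_sub_conj (ZetaZeros.riemannZetaNontrivialZeros.re_pos ρ.2)
      (ZetaZeros.riemannZetaNontrivialZeros.re_lt_one ρ.2)
  set e : ZetaZeros.riemannZetaNontrivialZeros ≃ ZetaZeros.riemannZetaNontrivialZeros :=
    Function.Involutive.toPerm J hJJ with he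
  have key : (fun ρ : ZetaZeros.riemannZetaNontrivialZeros ↦
      (riemannZetaZeroOrder (ρ : ℂ) : ℝ) * f (1 - conj (ρ : ℂ))) =
      (fun ρ : ZetaZeros.riemannZetaNontrivialZeros ↦
        (riemannZetaZeroOrder (ρ : ℂ) : ℝ) * f ρ) ∘ e := by
    funext ρ
    simp only [Function.comp_apply]
    rw [show ((e ρ : ZetaZeros.riemannZetaNontrivialZeros) : ℂ) = 1 - conj (ρ : ℂ) from rfl, hmJ ρ]
  refine ⟨?_, ?_⟩
  · rw [key]
    exact e.summable_iff
  · rw [key]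
    exact e.tsum_eq (fun ρ : ZetaZeros.riemannZetaNontrivialZeros ↦
      (riemannZetaZeroOrder (ρ : ℂ) : ℝ) * f ρ)

/-! ### The zero-side energy identity -/

/-- **Stub `stub_zeroSideEnergy` (W11b) — the RH-free zero-side energy identity of a Weil ground
state: the explicit formula AT the ground state.**  Assume (`HC`, the conclusion of the stub
`stub_samplingCauchy`) that for every ground state `u` at a window `a` and every minimising
sequence `gₙ → u` the zero samples converge in `ℓ²(m)`:
`Σ_ρ m(ρ)|û(ρ)|² < ∞` and `Σ_ρ m(ρ)|ĝₙ(ρ) - û(ρ)|² → 0`.  Then for every ground state `u` at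
the window `a`,
`Σ_ρ m(ρ) û(ρ) conj û(1 - ρ̄) = ε(a)`,
the sum over the non-trivial zeros of `ζ` (with multiplicity `m`) converging absolutely.
Proof: `Σ_ρ m(ρ) ĝₙ(ρ) conj ĝₙ(1 - ρ̄) = Q(gₙ) → ε(a)` (`hasSum_zeroSide_weilConv_weilReflect`,
`weilQuadratic_im_holds`), while the left side tends to `Σ_ρ m(ρ) û(ρ) conj û(1 - ρ̄)` by the
joint `ℓ²(m)`-continuity of the pairing (`zeroSideEnergy_tendsto_pairing`), the reflected
samples converging too (`zeroSideEnergy_reindex`). [folklore] -/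
theorem stub_zeroSideEnergy :
    (∀ (a : ℝ) (u : ℝ → ℂ) (g : ℕ → ℝ → ℂ), IsWeilGroundState a u →
      (∀ n, IsWeilTest (g n) ∧ tsupport (g n) ⊆ Icc (-a) a ∧ ∫ t, ‖g n t‖ ^ 2 = (1 : ℝ)) →
      Tendsto (fun n => (weilQuadratic (g n)).re) atTop (𝓝 (weilGroundEnergy a)) →
      Tendsto (fun n => ∫ t, ‖g n t - u t‖ ^ 2) atTop (𝓝 0) →
        Summable (fun ρ : ZetaZeros.riemannZetaNontrivialZeros =>
          (riemannZetaZeroOrder (ρ : ℂ) : ℝ) * ‖weilMellin u ρ‖ ^ 2) ∧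
        (∀ n, Summable (fun ρ : ZetaZeros.riemannZetaNontrivialZeros =>
          (riemannZetaZeroOrder (ρ : ℂ) : ℝ) * ‖weilMellin (g n) ρ - weilMellin u ρ‖ ^ 2)) ∧
        Tendsto (fun n => ∑' ρ : ZetaZeros.riemannZetaNontrivialZeros,
          (riemannZetaZeroOrder (ρ : ℂ) : ℝ) * ‖weilMellin (g n) ρ - weilMellin u ρ‖ ^ 2)
          atTop (𝓝 0)) →
    ∀ (a : ℝ) (u : ℝ → ℂ), IsWeilGroundState a u →
      HasSum (fun ρ : ZetaZeros.riemannZetaNontrivialZeros =>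
          (riemannZetaZeroOrder (ρ : ℂ) : ℂ) *
            (weilMellin u ρ * (starRingEnd ℂ) (weilMellin u (1 - (starRingEnd ℂ) (ρ : ℂ)))))
        ((weilGroundEnergy a : ℝ) : ℂ) := by
  intro HC a u hu
  obtain ⟨_, g, hg, hQ, hL⟩ := id hu
  obtain ⟨hS0, hS1, hS2⟩ := HC a u g hu hg hQ hL
  have hm0 : ∀ ρ : ZetaZeros.riemannZetaNontrivialZeros,
      (0 : ℝ) ≤ (riemannZetaZeroOrder (ρ : ℂ) : ℝ) := fun ρ ↦ by
    exact_mod_cast riemannZetaZeroOrder_nonneg (ZetaZeros.riemannZetaNontrivialZeros.ne_one ρ.2)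
  -- the reflected samples converge in `ℓ²(m)` as well
  have hS0' := zeroSideEnergy_reindex (fun s ↦ ‖weilMellin u s‖ ^ 2)
  have hS1' := fun n ↦ zeroSideEnergy_reindex (fun s ↦ ‖weilMellin (g n) s - weilMellin u s‖ ^ 2)
  have hS2' : Tendsto (fun n ↦ ∑' ρ : ZetaZeros.riemannZetaNontrivialZeros,
      (riemannZetaZeroOrder (ρ : ℂ) : ℝ) *
        ‖weilMellin (g n) (1 - conj (ρ : ℂ)) - weilMellin u (1 - conj (ρ : ℂ))‖ ^ 2)
      atTop (𝓝 0) := by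
    refine hS2.congr fun n ↦ ?_
    exact ((hS1' n).2).symm
  -- continuity of the pairing
  obtain ⟨hsum, hlim⟩ := zeroSideEnergy_tendsto_pairing hm0
    (A := fun ρ : ZetaZeros.riemannZetaNontrivialZeros ↦ weilMellin u ρ)
    (A' := fun ρ : ZetaZeros.riemannZetaNontrivialZeros ↦ weilMellin u (1 - conj (ρ : ℂ)))
    (B := fun n (ρ : ZetaZeros.riemannZetaNontrivialZeros) ↦ weilMellin (g n) ρ)
    (B' := fun n (ρ : ZetaZeros.riemannZetaNontrivialZeros) ↦ weilMellin (g n) (1 - conj (ρ : ℂ)))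
    hS0 (hS0'.1.2 hS0) hS1 (fun n ↦ (hS1' n).1.2 (hS1 n)) hS2 hS2'
  -- the approximating sums are `Q(gₙ) = Re Q(gₙ)`
  have hT : ∀ n, ∑' ρ : ZetaZeros.riemannZetaNontrivialZeros,
      (((riemannZetaZeroOrder (ρ : ℂ) : ℝ) : ℂ) *
        (weilMellin (g n) ρ * conj (weilMellin (g n) (1 - conj (ρ : ℂ))))) =
      (((weilQuadratic (g n)).re : ℝ) : ℂ) := by
    intro n
    have h := hasSum_zeroSide_weilConv_weilReflect (hg n).1 (hg n).1
    have hv : weilFunctional (weilConv (g n) (weilReflect (g n))) = weilQuadratic (g n) := rfl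
    rw [hv] at h
    simp_rw [Complex.ofReal_intCast]
    rw [h.tsum_eq]
    apply Complex.ext
    · simp
    · simp [weilQuadratic_im_holds (hg n).1]
  have hlimQ : Tendsto (fun n ↦ ∑' ρ : ZetaZeros.riemannZetaNontrivialZeros,
      (((riemannZetaZeroOrder (ρ : ℂ) : ℝ) : ℂ) *
        (weilMellin (g n) ρ * conj (weilMellin (g n) (1 - conj (ρ : ℂ))))))
      atTop (𝓝 ((weilGroundEnergy a : ℝ) : ℂ)) :=
    (hQ.ofReal).congr fun n ↦ (hT n).symm
  have heq := tendsto_nhds_unique hlim hlimQ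
  have hfin := hsum.hasSum
  rw [heq] at hfin
  refine hfin.congr_fun fun ρ ↦ ?_
  rw [Complex.ofReal_intCast]

end Summit.RiemannHypothesis.RiemannHypothesis.Theorems.GroundStatesConvergeToXi

end
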